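import Literature.MathematicalPhysics.QuantumFieldTheory.Balaban1983to89.B9Eq3153FrakGkBoundSlotDiagonal
import Literature.MathematicalPhysics.QuantumFieldTheory.Balaban1983to89.B9Eq3120DeltaPiPrimeFormTwoWindows

/-!
# `Balaban1983to89.B9Eq3153FrakGkBoundPiTwoWindows` — T. Bałaban, *Propagators for lattice gauge theories in a background field*, Commun. Math. Phys. **99**
# (1985) 389–434 [Balaban1985BackgroundPropagators] Thm 3.13 ∕ (3.153) p. 426, (3.126) p. 420, (3.122) p. 420, (3.130) p. 421, Thm 3.11 p. 416 and the class
# (3.35) p. 396, ON PRINT's DIAGONAL `ηL^{n+1} = 1`: **THM 3.13's `L²` CLAUSE FOR PRINT's `k`-TH-STEP LETTERS `G̃_k`, `H̃_kQ_kG̃_k`, `𝔊̃_k` OF THE OPERATOR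
# `Δ̃_{a,k}(U) = π_k†Δ^ηπ_k + D_UR_kD*_U + Q_k*aQ_k` (3.122) (`B9Eq3119DeltaPiTower.laplaceAkPi`) ON PRINT's CLASS (3.35) — NO θ, NO PROFILE, NO λ-LETTER** —
# the row OWNER t4-ne9-p1 g87's abstract-slot `B9Eq3153FrakGkBoundSlotDiagonal` §2–§4 at print's slot, with the form letter `θ := θα` INHABITED by this
# lineage's `B9Eq3120DeltaPiPrimeFormTwoWindows` §1 and the level-profile binders STRUCK by the α-linear two-window feed

statement-level skeleton of published theorems with citation tags; proofs where landed; nothing here is a claim about the Yang–Mills mass gap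

CITATION HEADER (lean-in-tree rule).  Audit cell `pub-balaban`, sub-cell `t4`, BINDER row NE9; filed by NE9 crux-team (2) leaf prover 03
(`b2b-balaban-t4-ne9-formalise-leaf-03`, gen 67), INTENT I-ne9leaf03-g67-D (journal [NE9LEAF03-G67-W5]; the OWNER's STAGED-8 named leaf-03 first refusal as «the
(3.35)-class neighbour»).  Host files: the OWNER's plan v7 «the Δ_π port» step (iv-𝔊) `B9Eq3153FrakGkBoundSlotDiagonal` (gen 87) and this lineage's
`B9Eq3120DeltaPiPrimeFormTwoWindows` (the θ-letter and (3.130) on print's class).  Sources READ in the held text `paper:balaban1985-cmp99-background-propagators`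
(journal page = PDF page + 388) pp. 396, 416, 419–421, 426.  Objects BY NAME: `laplaceAkPi`, `laplacePrimeAk`, `G1LatticeK`, `H1LatticeK`, `frakGLatticeK`, `QkW`,
`covCurlL2K`, `covDivL2K`; nothing re-declared, 0 `def`.

THE PRINT (verbatim).  p. 426: *«(3.147), (3.153) permit us to reduce properties of 𝔓, 𝔊 to the corresponding properties of G′, (Q′G′²Q′*)⁻¹, G₁, (QG₁Q*)⁻¹ …
Theorem 3.13»*; p. 420: *«It differs from the operator investigated in previous sections by the additional term Δ′_π, but we will prove that this term is a
small perturbation of Δ_a, and that the operator G used in the above formula has all the properties formulated in Theorems 3.3, 3.10, 3.11»*; p. 396: the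
class (3.35) — bonds `αη`-close, plaquettes `αη²`-close.

WHY THIS FILE (cell context).  DIAGNOSIS D-ne9p1-g87-1: print's `H` (3.126) and `𝔊` (3.153) are the letters of `G̃ = (Δ_π + DRD* + Q*aQ)⁻¹`, not of the
chain's `G₀`.  The OWNER's INTENT-8 gives the `L²`∕energy rows of `G̃_k`, `H̃_kQ_kG̃_k`, `𝔊̃_k` for ANY slot operator with an `N₁`-form defect `θ ≤ γ₁∕2`, on the
diagonal class with the level profile displayed.  At print's slot the defect is `θα` on print's class (`B9Eq3120DeltaPiPrimeFormTwoWindows` §1, from leaf-02's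
holonomy-commutator letter, the OWNER's assembly and leaf-02's λ-letters), and the profile is a consequence of the two windows (the feed).  This file composes:
host at `r = 1∕L`, feed at `β = Kα`, `Δ₁ :=` print's slot, `θ := θα` with `α₀` shrunk to `θα ≤ γ₁∕2` — the rows of Thm 3.13's `L²` clause for print's ACTUAL
letters on print's OWN class, `∃ α₀ C` before every binder.

WHAT IS PROVED (sorry-free; proof lane — 0 `def`; [folklore] binder plumbing + one threshold).  Common binders: `∀ n η (ηL^{n+1} = 1) c₀ c₁ (c₀(L^{n+1})^d = c₁)
(|η|^d∕c₀ ≤ ρ_w) m U (E162's data αU hα1 hU1 hreg) S (AvgClosed) (U(b) ∈ S) α (0 ≤ α ≤ α₀) hRS (‖U(b) − 1‖ ≤ αη) (‖U(∂p) − 1‖ ≤ αη²) hpos′` (ANY positivity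
witness of the site operator `Δ′_{a′,k}(U)` defining `G′_k`), then ANY positivity witness `hpos₁` of `laplaceAkPi …` (INHABITED on the class by
`B9Eq3120DeltaPiPrimeFormTwoWindows.exists_laplaceAkPi_perturbation_twoWindows'` (b) — not consumed here, displayed as the letters' own argument).
* §1 **`exists_norm_G1k_pi_le_twoWindows`** — `‖G̃_ky‖, ‖curl₁G̃_ky‖, ‖div₁G̃_ky‖ ≤ C‖y‖` (`G̃_k = G1LatticeK hpos₁`).
* §2 **`exists_norm_H1k_Qk_G1k_pi_le_twoWindows`** — under `hsymm : (laplaceAkPi …).IsSymmetric` (displayed; `laplaceAkPi_isSymmetric` on the unitary class) and ANY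
  onto-witness `hQ`: the three rows of `H̃_{1,k}(Q_k(G̃_ky))` `≤ C‖y‖`.
* §3 **`exists_norm_frakGk_pi_le_twoWindows`** — under `hsymm`, `hQ`: `‖𝔊̃_kx‖, ‖curl₁𝔊̃_kx‖, ‖div₁𝔊̃_kx‖ ≤ C‖x‖` (`𝔊̃_k = frakGLatticeK hpos₁ hQ`) — THM 3.13's `L²`
  CLAUSE FOR PRINT's `𝔊̃_k` ON (3.35).
HONEST SCOPE.  [folklore]; the two WINDOWS, E162's data, `hRS`, `ρ_w`, `hpos′`, `hsymm` and the witnesses stay HYPOTHESES; the fine-bond window is NOT derived from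
plaquettes (torus holonomies; per cube = the IMS road); `L²`∕energy currency on the diagonal only — no kernel bound, no decay, NOT the (N)-reading, NOT print's
uniformity over the complex class (3.38); the Lipschitz rows `H̃ − H`, `𝔊̃ − 𝔊` are NOT here (next storey).  Nothing of [B9] Thm 3.13 asserted as printed.  «NE9 ⇐ the
named binders»; NE9 NOT PRINTED ∕ NOT PROVED; NOT summit progress (cell pub-balaban: row NE9 WALLED ON A MODEL (O-NE9-1; #5 UNRULED); spine PROVED 0/9; rung (B)+1
finite T⁴ — NOT infinite volume, NOT mass gap, NOT BetaPertH, NOT Clay; HONEST DEPENDENCY: continuum YM on T⁴ ⇐ BetaPertH ∧ nine spine estimates (0/9 proved);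
BetaPertH ⇐ (D1) ∧ (D4) ∧ CAP+tail; G-an2-4 gates asym, D1 and NE2/3/4).  NEW file; nothing modified.  Net new unproved facts: 0.
-/

noncomputable section

open scoped InnerProductSpace ComplexConjugate BigOperators

namespace Literature.MathematicalPhysics.QuantumFieldTheory.Balaban1983to89.B9Eq3153FrakGkBoundPiTwoWindows

open B4Sect5Torus (TSite)
open B9SectCLatticeCarrier (Bond)
open B11Eq103H1Complex (SiteL2K BondL2K covDerivL2K covDivL2K laplaceALatticeK greenK G1LatticeK H1LatticeK frakGLatticeK)
open B9Eq310HessianOperator (adTransportW hessOp covCurlL2K)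
open B9Eq310DeltaPrime (plaqHolU)
open B9Eq315QTorus (perCfg cornerSite)
open B9Eq315QTower (towerP UlevOf)
open B9Eq326OperatorTower (laplaceAk QkW RofUk)
open B9Eq324DeltaPrimeATower (laplacePrimeAk GpOfUk)
open B9Eq3119DeltaPiTower (piOfUk laplaceAkPi)
open B7Prop1Explicit (U1 Wcx boxVec)
open B7Prop2Explicit (AvgClosed)
open B9Eq3153FrakGkBoundSlotDiagonal (exists_norm_G1k_slot_le_diagonal_closed exists_norm_H1k_Qk_G1k_slot_le_diagonal_closed
  exists_norm_frakGk_slot_le_diagonal_closed)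
open B9Eq3120DeltaPiPrimeFormTwoWindows (exists_form_defect_pi_twoWindows)
open B7Eq43AveragedSmallnessLinearFeed (twoWindows_linear_feed)

/-- The three thresholds shared by §1–§3: `α ≤ min T (min α_B (γ₁∕(2θ)))` gives `α ≤ T`, `α ≤ α_B`, `0 ≤ θα ≤ γ₁∕2`. [folklore] -/
private theorem thresholds {γ₁ θ T αB α : ℝ} (hθ : 0 < θ)
    (hαle : α ≤ min T (min αB (γ₁ / (2 * θ)))) (hα0 : 0 ≤ α) :
    α ≤ T ∧ α ≤ αB ∧ 0 ≤ θ * α ∧ θ * α ≤ γ₁ / 2 := by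
  have hαθ : α ≤ γ₁ / (2 * θ) := hαle.trans ((min_le_right _ _).trans (min_le_right _ _))
  rw [le_div_iff₀ (by positivity : (0 : ℝ) < 2 * θ)] at hαθ
  exact ⟨hαle.trans (min_le_left _ _), hαle.trans ((min_le_right _ _).trans (min_le_left _ _)), by positivity, by linarith⟩

variable {d : ℕ} (L : ℕ) [NeZero L] (hL : 1 ≤ L) (hL2 : 2 ≤ L)
  {𝔸 : Type*} [NormedRing 𝔸] [NormedAlgebra ℂ 𝔸] [CompleteSpace 𝔸] [NormOneClass 𝔸] [StarRing 𝔸] [NormedStarGroup 𝔸] [StarModule ℂ 𝔸]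
  {W : Type*} [NormedAddCommGroup W] [InnerProductSpace ℂ W] [FiniteDimensional ℂ W] (φ : W ≃ₗ[ℂ] 𝔸)
  {Mφ Mφ' : ℝ} (hMφ : 0 ≤ Mφ) (hMφ' : 0 ≤ Mφ') (hφ : ∀ w, ‖φ w‖ ≤ Mφ * ‖w‖) (hφ' : ∀ X, ‖φ.symm X‖ ≤ Mφ' * ‖X‖)
  {a : ℝ} (ha : 0 < a) {a' : ℝ} (ha' : 0 < a') (τ : 𝔸 →ₗ[ℂ] ℂ) {Cτ : ℝ} (hτ : ∀ X, ‖τ X‖ ≤ Cτ * ‖X‖) (hCτ : 0 ≤ Cτ) {ρw : ℝ} (hρw : 0 ≤ ρw)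

include hL2 hMφ hMφ' hφ hφ' ha ha' hτ hCτ hρw

/-! ## §1 The Green's function `G̃_k(U)` of print's operator and its flat `D`-rows on print's class -/

set_option maxRecDepth 8192 in
/-- **THE GREEN's FUNCTION `G̃_k(U) = (Δ̃_{a,k}(U))⁻¹` OF PRINT's OPERATOR (3.122) ON PRINT's CLASS (3.35)**: `∃ α₀ C > 0` first, then on the class, for ANY
`hpos′` and ANY positivity witness `hpos₁` of `laplaceAkPi …`: `‖G̃_ky‖, ‖curl₁G̃_ky‖, ‖div₁G̃_ky‖ ≤ C‖y‖` — the OWNER's `exists_norm_G1k_slot_le_diagonal_closed` at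
`r = 1∕L`, `β = Kα`, `Δ₁ :=` print's slot, `θ := θα` (`B9Eq3120DeltaPiPrimeFormTwoWindows.exists_form_defect_pi_twoWindows`), `θα ≤ γ₁∕2` by the threshold. [folklore]
[cite: Balaban1985BackgroundPropagators, Thm 3.13 p.426, (3.130) p.421, (3.122) p.420, Thm 3.11 p.416, (3.35)–(3.37) p.396; Balaban1985Averaging, Prop. 2 (52)–(54) p.26] -/
theorem exists_norm_G1k_pi_le_twoWindows :
    ∃ α₀ C : ℝ, 0 < α₀ ∧ 0 < C ∧ ∀ (n : ℕ) (η : ℝ), η * (L : ℝ) ^ (n + 1) = 1 →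
      ∀ (c₀ c₁ : ℝ) [Fact (0 < c₀)] [Fact (0 < c₁)], c₀ * ((L : ℝ) ^ (n + 1)) ^ d = c₁ → |η| ^ d / c₀ ≤ ρw →
      ∀ (m : Fin d → ℕ) [∀ i, NeZero (m i)] (U : Bond d (towerP L m (n + 1)) → 𝔸ˣ) (αU : ℕ → ℝ) (hα1 : ∀ j, αU j ≤ 1 / 64)
        (hU1 : ∀ (j : ℕ) (x : B7Prop1Explicit.Site d) (κ : Fin d), perCfg (towerP L m (j + 1)) (UlevOf L m (n + 1) U j) x κ ∈ U1 𝔸)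
        (hreg : ∀ (j : ℕ) (y : TSite d (towerP L m j)) (κ : Fin d) (r : Fin d → Fin L),
          ‖((Wcx L (perCfg (towerP L m (j + 1)) (UlevOf L m (n + 1) U j)) (cornerSite L y) κ (boxVec L r) : 𝔸ˣ) : 𝔸) - 1‖ ≤ αU j)
        {S : Subgroup 𝔸ˣ}, AvgClosed d L S → (∀ b, U b ∈ S) →
      ∀ {α : ℝ}, 0 ≤ α → α ≤ α₀ →
        (∀ (b : Bond d (towerP L m (n + 1))) (v u : W), ⟪adTransportW φ U b v, u⟫_ℂ = ⟪v, adTransportW φ (fun b => (U b)⁻¹) b u⟫_ℂ) →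
        (∀ b, ‖(U b : 𝔸) - 1‖ ≤ α * η) →
        (∀ p : B9SectCLatticeCarrier.Plaq d (towerP L m (n + 1)), ‖(plaqHolU U p : 𝔸) - 1‖ ≤ α * η ^ 2) →
        ∀ (hpos' : ∀ x : SiteL2K ℂ d (towerP L m (n + 1)) c₀ W, x ≠ 0 →
          0 < RCLike.re ⟪x, laplacePrimeAk L m n φ η U a' (c₁ := c₁) x⟫_ℂ),
        ∀ (hpos₁ : ∀ x : BondL2K ℂ d (towerP L m (n + 1)) c₀ W, x ≠ 0 →
            0 < RCLike.re ⟪x, laplaceAkPi L m n φ τ η U a' hpos' hL αU hα1 hU1 hreg (c₁ := c₁) a x⟫_ℂ)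
          (y : BondL2K ℂ d (towerP L m (n + 1)) c₀ W),
          ‖G1LatticeK hpos₁ y‖ ≤ C * ‖y‖ ∧
          ‖covCurlL2K ℂ c₀ ((η : ℂ))⁻¹ (adTransportW φ (fun _ : Bond d (towerP L m (n + 1)) => (1 : 𝔸ˣ))) (G1LatticeK hpos₁ y)‖ ≤ C * ‖y‖ ∧
          ‖covDivL2K ℂ c₀ ((η : ℂ))⁻¹ (adTransportW φ fun _ : Bond d (towerP L m (n + 1)) => (1 : 𝔸ˣ)⁻¹) (G1LatticeK hpos₁ y)‖ ≤ C * ‖y‖ := by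
  have hL0 : (0 : ℝ) < L := by exact_mod_cast lt_of_lt_of_le (by norm_num) hL2
  have hr0 : (0 : ℝ) ≤ 1 / (L : ℝ) := by positivity
  have hr1 : 1 / (L : ℝ) < 1 := by rw [div_lt_one hL0]; exact_mod_cast lt_of_lt_of_le (by norm_num) hL2
  -- the OWNER's abstract-slot rows at `r = 1∕L`
  obtain ⟨α₁, γ₁, C, hα₁, hγ₁, hC, H⟩ := exists_norm_G1k_slot_le_diagonal_closed (d := d) L hL φ hMφ hMφ' hφ hφ' ha hr0 hr1 τ hτ hCτ hρw
  -- the α-linear feed below the host's threshold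
  obtain ⟨T, hT, F⟩ := twoWindows_linear_feed L hL2 (d := d) (𝔸 := 𝔸) hα₁
  -- the θ-letter of print's slot on the class
  obtain ⟨αB, θ, hαB, hθ, HB⟩ := exists_form_defect_pi_twoWindows (d := d) L hL2 φ hMφ hMφ' hφ hφ' ha' τ hτ hCτ hρw
  have hγθ : 0 < γ₁ / (2 * θ) := by positivity
  refine ⟨min T (min αB (γ₁ / (2 * θ))), C, lt_min hT (lt_min hαB hγθ), hC, ?_⟩
  intro n η hηL c₀ c₁ _ _ hw hρ m _ U αU hα1 hU1 hreg S hS hU α hα0 hαle hRS hUη hpl hpos' hpos₁ y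
  obtain ⟨hαT, hαB', hθα0, hθαle⟩ := thresholds hθ hαle hα0
  obtain ⟨hβ0, hβ1, hUb, hUη', hpl', hU1', εU, hεU, hUε, hεg⟩ := F m n hS hU hηL hα0 hαT hUη hpl
  have hform := HB n η hηL c₀ c₁ hw hρ m U hRS hS hU α hα0 hαB' hUη hpl hpos'
  exact H n η hηL c₀ c₁ hw hρ m U αU hα1 hU1 hreg εU hεU hUε hβ0 hβ1 hRS hUb hUη' hpl' hεg _ hθα0 hθαle (fun u v => hform u v) hpos₁ y

/-! ## §2 The middle piece `H̃_{1,k}Q_kG̃_k` on print's class -/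

set_option maxRecDepth 8192 in
/-- **`H̃_{1,k}(U)Q_k(U)G̃_k(U)` IN THE ENERGY NORM ON PRINT's CLASS (3.35)**: under `hsymm` (displayed) and ANY `hpos′`, `hpos₁`, `hQ`: the three rows
`≤ C‖y‖` — the OWNER's `exists_norm_H1k_Qk_G1k_slot_le_diagonal_closed` at print's slot with `θ := θα`. [folklore]
[cite: Balaban1985BackgroundPropagators, (3.126) p.420, (3.153) p.426, Thm 3.13 p.426, Thm 3.11 p.416, (3.35)–(3.37) p.396; Balaban1985Variational, (45)–(46) p.285] -/
theorem exists_norm_H1k_Qk_G1k_pi_le_twoWindows :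
    ∃ α₀ C : ℝ, 0 < α₀ ∧ 0 < C ∧ ∀ (n : ℕ) (η : ℝ), η * (L : ℝ) ^ (n + 1) = 1 →
      ∀ (c₀ c₁ : ℝ) [Fact (0 < c₀)] [Fact (0 < c₁)], c₀ * ((L : ℝ) ^ (n + 1)) ^ d = c₁ → |η| ^ d / c₀ ≤ ρw →
      ∀ (m : Fin d → ℕ) [∀ i, NeZero (m i)] (U : Bond d (towerP L m (n + 1)) → 𝔸ˣ) (αU : ℕ → ℝ) (hα1 : ∀ j, αU j ≤ 1 / 64)
        (hU1 : ∀ (j : ℕ) (x : B7Prop1Explicit.Site d) (κ : Fin d), perCfg (towerP L m (j + 1)) (UlevOf L m (n + 1) U j) x κ ∈ U1 𝔸)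
        (hreg : ∀ (j : ℕ) (y : TSite d (towerP L m j)) (κ : Fin d) (r : Fin d → Fin L),
          ‖((Wcx L (perCfg (towerP L m (j + 1)) (UlevOf L m (n + 1) U j)) (cornerSite L y) κ (boxVec L r) : 𝔸ˣ) : 𝔸) - 1‖ ≤ αU j)
        {S : Subgroup 𝔸ˣ}, AvgClosed d L S → (∀ b, U b ∈ S) →
      ∀ {α : ℝ}, 0 ≤ α → α ≤ α₀ →
        (∀ (b : Bond d (towerP L m (n + 1))) (v u : W), ⟪adTransportW φ U b v, u⟫_ℂ = ⟪v, adTransportW φ (fun b => (U b)⁻¹) b u⟫_ℂ) →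
        (∀ b, ‖(U b : 𝔸) - 1‖ ≤ α * η) →
        (∀ p : B9SectCLatticeCarrier.Plaq d (towerP L m (n + 1)), ‖(plaqHolU U p : 𝔸) - 1‖ ≤ α * η ^ 2) →
        ∀ (hpos' : ∀ x : SiteL2K ℂ d (towerP L m (n + 1)) c₀ W, x ≠ 0 →
          0 < RCLike.re ⟪x, laplacePrimeAk L m n φ η U a' (c₁ := c₁) x⟫_ℂ),
        (laplaceAkPi L m n φ τ η U a' hpos' hL αU hα1 hU1 hreg (c₁ := c₁) a).IsSymmetric →
        ∀ (hpos₁ : ∀ x : BondL2K ℂ d (towerP L m (n + 1)) c₀ W, x ≠ 0 →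
            0 < RCLike.re ⟪x, laplaceAkPi L m n φ τ η U a' hpos' hL αU hα1 hU1 hreg (c₁ := c₁) a x⟫_ℂ)
          (hQ : Function.Surjective (QkW L m n φ U hL αU hα1 hU1 hreg (c₁ := c₁)))
          (y : BondL2K ℂ d (towerP L m (n + 1)) c₀ W),
          ‖H1LatticeK hpos₁ hQ (QkW L m n φ U hL αU hα1 hU1 hreg (c₁ := c₁) (G1LatticeK hpos₁ y))‖ ≤ C * ‖y‖ ∧
          ‖covCurlL2K ℂ c₀ ((η : ℂ))⁻¹ (adTransportW φ (fun _ : Bond d (towerP L m (n + 1)) => (1 : 𝔸ˣ)))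
              (H1LatticeK hpos₁ hQ (QkW L m n φ U hL αU hα1 hU1 hreg (c₁ := c₁) (G1LatticeK hpos₁ y)))‖ ≤ C * ‖y‖ ∧
          ‖covDivL2K ℂ c₀ ((η : ℂ))⁻¹ (adTransportW φ fun _ : Bond d (towerP L m (n + 1)) => (1 : 𝔸ˣ)⁻¹)
              (H1LatticeK hpos₁ hQ (QkW L m n φ U hL αU hα1 hU1 hreg (c₁ := c₁) (G1LatticeK hpos₁ y)))‖ ≤ C * ‖y‖ := by
  have hL0 : (0 : ℝ) < L := by exact_mod_cast lt_of_lt_of_le (by norm_num) hL2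
  have hr0 : (0 : ℝ) ≤ 1 / (L : ℝ) := by positivity
  have hr1 : 1 / (L : ℝ) < 1 := by rw [div_lt_one hL0]; exact_mod_cast lt_of_lt_of_le (by norm_num) hL2
  -- the OWNER's abstract-slot rows at `r = 1∕L`
  obtain ⟨α₁, γ₁, C, hα₁, hγ₁, hC, H⟩ := exists_norm_H1k_Qk_G1k_slot_le_diagonal_closed (d := d) L hL φ hMφ hMφ' hφ hφ' ha hr0 hr1 τ hτ hCτ hρw
  -- the α-linear feed below the host's threshold
  obtain ⟨T, hT, F⟩ := twoWindows_linear_feed L hL2 (d := d) (𝔸 := 𝔸) hα₁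
  -- the θ-letter of print's slot on the class
  obtain ⟨αB, θ, hαB, hθ, HB⟩ := exists_form_defect_pi_twoWindows (d := d) L hL2 φ hMφ hMφ' hφ hφ' ha' τ hτ hCτ hρw
  have hγθ : 0 < γ₁ / (2 * θ) := by positivity
  refine ⟨min T (min αB (γ₁ / (2 * θ))), C, lt_min hT (lt_min hαB hγθ), hC, ?_⟩
  intro n η hηL c₀ c₁ _ _ hw hρ m _ U αU hα1 hU1 hreg S hS hU α hα0 hαle hRS hUη hpl hpos' hsymm hpos₁ hQ y
  obtain ⟨hαT, hαB', hθα0, hθαle⟩ := thresholds hθ hαle hα0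
  obtain ⟨hβ0, hβ1, hUb, hUη', hpl', hU1', εU, hεU, hUε, hεg⟩ := F m n hS hU hηL hα0 hαT hUη hpl
  have hform := HB n η hηL c₀ c₁ hw hρ m U hRS hS hU α hα0 hαB' hUη hpl hpos'
  exact H n η hηL c₀ c₁ hw hρ m U αU hα1 hU1 hreg εU hεU hUε hβ0 hβ1 hRS hUb hUη' hpl' hεg _ hθα0 hθαle (fun u v => hform u v) hsymm hpos₁ hQ y

/-! ## §3 Thm 3.13's `L²` clause for print's `𝔊̃_k` on print's class -/

set_option maxRecDepth 8192 in
/-- **[B9] THM 3.13's `L²` CLAUSE FOR PRINT's `k`-TH-STEP `𝔊̃_k(U)` ON PRINT's CLASS (3.35) — NO θ, NO PROFILE, NO λ-LETTER**: `∃ α₀ C > 0` first, then on the class,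
under `hsymm` (displayed) and ANY `hpos′`, `hpos₁`, `hQ`: `‖𝔊̃_kx‖, ‖curl₁𝔊̃_kx‖, ‖div₁𝔊̃_kx‖ ≤ C‖x‖` for `𝔊̃_k = frakGLatticeK hpos₁ hQ` at `laplaceAkPi …` — print's `𝔊`
of (3.126)∕(3.153) built on `G̃` of (3.130); the OWNER's `exists_norm_frakGk_slot_le_diagonal_closed` at print's slot with `θ := θα`. [folklore]
[cite: Balaban1985BackgroundPropagators, Thm 3.13 p.426, (3.153) p.426, (3.130) p.421, (3.122) p.420, Thm 3.11 p.416, (3.35)–(3.37) p.396; Balaban1985Averaging, Prop. 2 (52)–(54) p.26] -/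
theorem exists_norm_frakGk_pi_le_twoWindows :
    ∃ α₀ C : ℝ, 0 < α₀ ∧ 0 < C ∧ ∀ (n : ℕ) (η : ℝ), η * (L : ℝ) ^ (n + 1) = 1 →
      ∀ (c₀ c₁ : ℝ) [Fact (0 < c₀)] [Fact (0 < c₁)], c₀ * ((L : ℝ) ^ (n + 1)) ^ d = c₁ → |η| ^ d / c₀ ≤ ρw →
      ∀ (m : Fin d → ℕ) [∀ i, NeZero (m i)] (U : Bond d (towerP L m (n + 1)) → 𝔸ˣ) (αU : ℕ → ℝ) (hα1 : ∀ j, αU j ≤ 1 / 64)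
        (hU1 : ∀ (j : ℕ) (x : B7Prop1Explicit.Site d) (κ : Fin d), perCfg (towerP L m (j + 1)) (UlevOf L m (n + 1) U j) x κ ∈ U1 𝔸)
        (hreg : ∀ (j : ℕ) (y : TSite d (towerP L m j)) (κ : Fin d) (r : Fin d → Fin L),
          ‖((Wcx L (perCfg (towerP L m (j + 1)) (UlevOf L m (n + 1) U j)) (cornerSite L y) κ (boxVec L r) : 𝔸ˣ) : 𝔸) - 1‖ ≤ αU j)
        {S : Subgroup 𝔸ˣ}, AvgClosed d L S → (∀ b, U b ∈ S) →
      ∀ {α : ℝ}, 0 ≤ α → α ≤ α₀ →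
        (∀ (b : Bond d (towerP L m (n + 1))) (v u : W), ⟪adTransportW φ U b v, u⟫_ℂ = ⟪v, adTransportW φ (fun b => (U b)⁻¹) b u⟫_ℂ) →
        (∀ b, ‖(U b : 𝔸) - 1‖ ≤ α * η) →
        (∀ p : B9SectCLatticeCarrier.Plaq d (towerP L m (n + 1)), ‖(plaqHolU U p : 𝔸) - 1‖ ≤ α * η ^ 2) →
        ∀ (hpos' : ∀ x : SiteL2K ℂ d (towerP L m (n + 1)) c₀ W, x ≠ 0 →
          0 < RCLike.re ⟪x, laplacePrimeAk L m n φ η U a' (c₁ := c₁) x⟫_ℂ),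
        (laplaceAkPi L m n φ τ η U a' hpos' hL αU hα1 hU1 hreg (c₁ := c₁) a).IsSymmetric →
        ∀ (hpos₁ : ∀ x : BondL2K ℂ d (towerP L m (n + 1)) c₀ W, x ≠ 0 →
            0 < RCLike.re ⟪x, laplaceAkPi L m n φ τ η U a' hpos' hL αU hα1 hU1 hreg (c₁ := c₁) a x⟫_ℂ)
          (hQ : Function.Surjective (QkW L m n φ U hL αU hα1 hU1 hreg (c₁ := c₁)))
          (x : BondL2K ℂ d (towerP L m (n + 1)) c₀ W),
          ‖frakGLatticeK hpos₁ hQ x‖ ≤ C * ‖x‖ ∧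
          ‖covCurlL2K ℂ c₀ ((η : ℂ))⁻¹ (adTransportW φ (fun _ : Bond d (towerP L m (n + 1)) => (1 : 𝔸ˣ))) (frakGLatticeK hpos₁ hQ x)‖ ≤ C * ‖x‖ ∧
          ‖covDivL2K ℂ c₀ ((η : ℂ))⁻¹ (adTransportW φ fun _ : Bond d (towerP L m (n + 1)) => (1 : 𝔸ˣ)⁻¹) (frakGLatticeK hpos₁ hQ x)‖ ≤ C * ‖x‖ := by
  have hL0 : (0 : ℝ) < L := by exact_mod_cast lt_of_lt_of_le (by norm_num) hL2
  have hr0 : (0 : ℝ) ≤ 1 / (L : ℝ) := by positivity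
  have hr1 : 1 / (L : ℝ) < 1 := by rw [div_lt_one hL0]; exact_mod_cast lt_of_lt_of_le (by norm_num) hL2
  -- the OWNER's abstract-slot rows at `r = 1∕L`
  obtain ⟨α₁, γ₁, C, hα₁, hγ₁, hC, H⟩ := exists_norm_frakGk_slot_le_diagonal_closed (d := d) L hL φ hMφ hMφ' hφ hφ' ha hr0 hr1 τ hτ hCτ hρw
  -- the α-linear feed below the host's threshold
  obtain ⟨T, hT, F⟩ := twoWindows_linear_feed L hL2 (d := d) (𝔸 := 𝔸) hα₁
  -- the θ-letter of print's slot on the class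
  obtain ⟨αB, θ, hαB, hθ, HB⟩ := exists_form_defect_pi_twoWindows (d := d) L hL2 φ hMφ hMφ' hφ hφ' ha' τ hτ hCτ hρw
  have hγθ : 0 < γ₁ / (2 * θ) := by positivity
  refine ⟨min T (min αB (γ₁ / (2 * θ))), C, lt_min hT (lt_min hαB hγθ), hC, ?_⟩
  intro n η hηL c₀ c₁ _ _ hw hρ m _ U αU hα1 hU1 hreg S hS hU α hα0 hαle hRS hUη hpl hpos' hsymm hpos₁ hQ x
  obtain ⟨hαT, hαB', hθα0, hθαle⟩ := thresholds hθ hαle hα0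
  obtain ⟨hβ0, hβ1, hUb, hUη', hpl', hU1', εU, hεU, hUε, hεg⟩ := F m n hS hU hηL hα0 hαT hUη hpl
  have hform := HB n η hηL c₀ c₁ hw hρ m U hRS hS hU α hα0 hαB' hUη hpl hpos'
  exact H n η hηL c₀ c₁ hw hρ m U αU hα1 hU1 hreg εU hεU hUε hβ0 hβ1 hRS hUb hUη' hpl' hεg _ hθα0 hθαle (fun u v => hform u v) hsymm hpos₁ hQ x

end Literature.MathematicalPhysics.QuantumFieldTheory.Balaban1983to89.B9Eq3153FrakGkBoundPiTwoWindows

end
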